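import Literature.AlgebraicGeometry.AbelianVarieties.PicZeroCohomologyVanishing
import Literature.AlgebraicGeometry.AbelianSchemes.AbelianSchemeKOfL
import Literature.AlgebraicGeometry.Modules.CechProductCoverColumnCollapse
import Literature.AlgebraicGeometry.Modules.CechPicOfLocalRing
import HarnessLib

/-!
# Mumford's kernel family `K = Λ(𝒪(Θ)) ⊗ p₂^*𝒪(−D)` on `A × A` and its two slices
# (Mumford, *Abelian Varieties*, §8 Thm. 1 (p. 77), proof; the (CBC-3) brick of the char-free «PIC⁰-ONTO»)

Layer `Literature/AlgebraicGeometry/AbelianVarieties`, namespace `Literature.AlgebraicGeometry.AbelianVarieties`.  PROOF file (theorems only;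
no definition, no named fact, no instance, no notation, no `sorry`).  Cell `hodgecm-mathlib` (D-0151), DUAL-S road (A), «CBC cut» (B-p08 (g33)
memo v1 §1 (CBC-3); census + statement plan B-p10 (g29)); consumer = (CBC-4) [MumfordAV1970] §8 Thm. 1 in ANY characteristic
(`AbelianVarieties/PicZeroOntoOfFiniteKTheta`).  Everything is stated for the abelian variety `A = B.X` over a field `k` and its square
`(B.X ⊗ B.X).left` with the Mathlib projections `(fst B.X B.X).left`, `(snd B.X B.X).left` and the group law `(μ[B.X]).left` (no auxiliary
abelian-scheme wrapper), rational points `x : B.Points k` (`x.toSpecHom : Spec k → A`), divisors through their classes in `Ȟ¹(A, 𝒪^×)`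
(★ `CartierDivisor.cechClass`, ★ `detClass`).

THE MATHEMATICS ([MumfordAV1970] §8, proof of Thm. 1, p. 77).  `L = 𝒪(Θ)`, `M = 𝒪(D)` with `t_x^*D ∼ D` for all `x ∈ A(k)`; Mumford's kernel
family is the line bundle `K = m^*L ⊗ p₁^*L⁻¹ ⊗ p₂^*(L⁻¹ ⊗ M⁻¹)` on `A × A`.  Its restriction to `{x} × A` is `t_x^*L ⊗ L⁻¹ ⊗ M⁻¹ = 𝒪(D_x − D)`
(`D_x = t_x^*Θ − Θ`, ★ `AbelianVariety.weilDiv`), its restriction to `A × {y}` is `t_y^*L ⊗ L⁻¹ = 𝒪(D_y)` (the `p₂^*` factor dies on a point).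
Both are in `Pic⁰` (theorem of the square); so by [MumfordAV1970] §8 (vii) (★ (D1) `PicZeroCohomologyVanishing`) ALL their Čech cohomology
vanishes unless they are trivial, i.e. unless `D ∼ D_x`, resp. `y ∈ K(Θ)`; and at `y = 1` the slice is `𝒪_A`, whose `Ȟ⁰ ∋ 1 ≠ 0`.

* §1 (class level, on `A`) `subsingleton_cechComplex_homology_of_detClass_translation_invariant` — ★ (D1) read on the CLASS: a rank-one module
  whose class is translation invariant and `≠ 1` has `Ȟⁿ(𝓤, M) = 0` for every `n : ℤ`, every finite affine cover `𝓤`, ANY scalars (`k = k̄`);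
  `nontrivial_cechComplex_homology_zero_of_detClass_eq_one` (class `1` ⇒ `Ȟ⁰ ≠ 0`); `cechPic_pullback_translation_cechClass_weilDiv`
  (`t_P^*[D_Q] = [D_Q]`, theorem of the square); the three instances **(b′)** class `[D_x]·[D]⁻¹`, `D ∈ Pic⁰`, `D ≁ D_x` ⇒ acyclic;
  **(c′)** class `[D_y]`, `D_y ≁ 0` ⇒ acyclic; **(c₀′)** class `[D_y]`, `D_y ∼ 0` ⇒ `Ȟ⁰ ≠ 0`.
* §2 the slices `sliceFst x = (x, 𝟙) : A → A × A` and `sliceSnd y = (𝟙, y)`: their composites with `p₁, p₂, m` (`t_x`, by ★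
  `AbelianVariety.translation = (A → Spec k → A) · 𝟙`), **`isPullback_sliceFst` / `isPullback_sliceSnd`** (they present the fibres of `p₁`, `p₂`
  at `x`, `y` as CARTESIAN SQUARES — the (S2) currency of ★ (CBC-1) `CechComplexFibreExactOfExact`, any presentation), and the classes they see:
  `sliceFst(x)^*[K] = [D_x]·[D]⁻¹`, `sliceSnd(y)^*[K] = [D_y]` for the KERNEL CLASS `[K] = m^*[Θ]·(p₁^*[Θ])⁻¹·(p₂^*([Θ][D]))⁻¹`
  (`Ȟ¹(Spec k, 𝒪^×) = 1`, ★ `CechPic.pullback_eq_one_of_isLocalRing`).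
* §3 ONE kernel family `K₀ = m^*𝒪(Θ) ⊗ (p₁^*𝒪(−Θ) ⊗ p₂^*𝒪(−(Θ + D)))`: rank one, class `[K]` (`hasRank_kernelFamily`, `detClass_kernelFamily`).
* §4 THE HEADS, for ANY rank-one `K` on `A × A` of class `[K]` (presentation-robust): **(b) `exactAt_cechComplex_pullback_sliceFst`** — for `x` with
  `D ≁ D_x` the Čech complex of `sliceFst(x)^*K` on every finite affine cover of `A` is exact in EVERY degree; **(c) `exactAt_cechComplex_pullback_sliceSnd`**
  — the same for `sliceSnd(y)^*K`, `D_y ≁ 0`; **(c₀) `not_exactAt_zero_cechComplex_pullback_sliceSnd`** — for `D_y ∼ 0` (e.g. `y = 1`, ★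
  `weilDiv_one_linEquiv_zero`) it is NOT exact in degree `0`.

HC_CM is proved only modulo the printed citations until rung 0 closes — nothing here bears on a summit statement; count-neutral ★ capital.

## References
* [MumfordAV1970] D. Mumford, *Abelian Varieties* (1970), §8 Thm. 1 (p. 77) and its proof; §8 (ii)–(iv), (vii) (pp. 74–76); §6 Cor. 4 (p. 59).
* [GortzWedhorn2023] U. Görtz, T. Wedhorn, *Algebraic Geometry II* (2023), Lemma 27.197 (PDF p. 893), Def. 27.1 (p. 799), Def. 21.68 (p. 180).
* [Hartshorne1977] R. Hartshorne, *Algebraic Geometry* (1977), II Ex. 6.8, III Ex. 4.5, III Thm. 4.5.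
* [MumfordFogartyKirwan1994] D. Mumford, J. Fogarty, F. Kirwan, *Geometric Invariant Theory*, 3rd ed. (1994), Ch. 6 §2 Definition 6.2 (p. 120).
* [StacksProject] The Stacks Project, Tag 01JO (fibre products / base change), Tag 0BEC.
-/

noncomputable section

set_option backward.isDefEq.respectTransparency false

open CategoryTheory CategoryTheory.Limits AlgebraicGeometry TopologicalSpace Opposite MonoidalCategory CartesianMonoidalCategory
open scoped MonObj

namespace Literature.AlgebraicGeometry.AbelianVarieties

open Literature.AlgebraicGeometry.Motives Literature.AlgebraicGeometry.Modules Literature.AlgebraicGeometry.Morphisms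
  Literature.AlgebraicGeometry.AbelianSchemes Literature.AlgebraicGeometry.AbelianSchemes.AbelianVarietyCech
  Literature.Algebra.Homology

universe u

/-! ## §1 Čech cohomology of a rank-one module on `A` from its class -/

section Classes

variable {k : Type} [Field k] (B : AbelianVariety k) {M : B.X.left.Modules} (h₁ : HasRank M 1)
  {I : Type} [LinearOrder I] [Fintype I] (U : I → B.X.left.affineOpens) (hcov : ⨆ i, (U i).1 = ⊤)
  {R : Type} [CommRing R] (ρ : R →+* Γ(B.X.left, ⊤))

include hcov in
/-- **`Ȟⁿ(𝓤, M) = 0` for a rank-one `M` whose CLASS is translation invariant and non-trivial** (`k = k̄`, every `n : ℤ`, every finite affine open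
cover `𝓤` of `A`, any ring of scalars): ★ (D1) `subsingleton_cechComplex_homology_of_isHomogeneous'` read through ★ `isHomogeneous_iff_forall_pullback_detClass_eq`
(`t_P^*M ≅ M ⟺ t_P^*[M] = [M]`), ★ `nonempty_iso_iff_detClass_eq` (`M ≅ 𝒪 ⟺ [M] = 1`) and ★ `subsingleton_homology_cechComplex_iff_of_scalars`.
[cite: MumfordAV1970, §8 (vii) (p. 76)] [cite: GortzWedhorn2023, Lemma 27.197 (PDF p. 893)] -/
theorem subsingleton_cechComplex_homology_of_detClass_translation_invariant [IsAlgClosed k]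
    (hinv : ∀ P : B.Points k, CechPic.pullback (B.translation P).left (detClass (HasRank.isFiniteLocallyFree' h₁)) =
      detClass (HasRank.isFiniteLocallyFree' h₁))
    (hne : detClass (HasRank.isFiniteLocallyFree' h₁) ≠ 1) (n : ℤ) :
    Subsingleton ((cechComplex (fun i => (U i).1) M ρ).homology n) := by
  have hL : IsHomogeneous B M := (isHomogeneous_iff_forall_pullback_detClass_eq B h₁ (HasRank.isFiniteLocallyFree' h₁)).2 hinv
  have hne' : IsEmpty (M ≅ unitModule B.X.left) := ⟨fun e => hne (by
    rw [detClass_eq_of_iso e (HasRank.isFiniteLocallyFree' h₁) (HasRank.isFiniteLocallyFree' hasRank_unitModule),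
      detClass_unitModule_eq_one])⟩
  rw [subsingleton_homology_cechComplex_iff_of_scalars (fun i => (U i).1) M ρ (scalarRingHomTop B.X) n]
  exact subsingleton_cechComplex_homology_of_isHomogeneous' B h₁ hL hne' U hcov n

include hcov in
omit [Fintype I] in
/-- **`Ȟ⁰(𝓤, M) ≠ 0` for a rank-one `M` of class `1`** (then `M ≅ 𝒪_A`, ★ `nonempty_iso_unitModule_of_detClass_eq_one`, and `Ȟ⁰(𝓤, 𝒪_A) ∋ 1 ≠ 0` on the
integral `A`, ★ `nontrivial_cechComplex_homology_zero_unitModule`, transported along ★ `sectionsSystemIsoOfIso`). [cite: GortzWedhorn2023, Lemma 21.65 (p. 179)]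
[cite: Hartshorne1977, III Ex. 4.5] -/
theorem nontrivial_cechComplex_homology_zero_of_detClass_eq_one
    (h1 : detClass (HasRank.isFiniteLocallyFree' h₁) = 1) :
    Nontrivial ((cechComplex (fun i => (U i).1) M ρ).homology 0) := by
  obtain ⟨e⟩ := nonempty_iso_unitModule_of_detClass_eq_one h₁ (HasRank.isFiniteLocallyFree' h₁) h1
  haveI : Nontrivial ((HomologicalComplex.homologyFunctor (ModuleCat R) (ComplexShape.up ℤ) 0).obj
      (cechComplex (fun i => (U i).1) (unitModule B.X.left) ρ)) :=
    nontrivial_cechComplex_homology_zero_unitModule (fun i => (U i).1) ρ hcov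
  let φ := (HomologicalComplex.homologyFunctor (ModuleCat R) (ComplexShape.up ℤ) 0).mapIso
    (sectionsSystemIsoOfIso (fun i => (U i).1) e ρ)
  have hinj : Function.Injective φ.inv := (ConcreteCategory.bijective_of_isIso φ.inv).1
  exact hinj.nontrivial


include hcov in
omit [Fintype I] in
/-- `ExactAt` form: the Čech complex of a rank-one module of class `1` is NOT exact in degree `0`. [cite: GortzWedhorn2023, Lemma 21.65 (p. 179)] -/
theorem not_exactAt_zero_cechComplex_of_detClass_eq_one (h1 : detClass (HasRank.isFiniteLocallyFree' h₁) = 1) :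
    ¬ (cechComplex (fun i => (U i).1) M ρ).ExactAt 0 := by
  rw [exactAt_iff_subsingleton_homology, not_subsingleton_iff_nontrivial]
  exact nontrivial_cechComplex_homology_zero_of_detClass_eq_one B h₁ U hcov ρ h1

omit [Fintype I] in
/-- **`t_P^*[D_Q] = [D_Q]`**: the class of `D_Q = t_Q^*Θ − Θ` (★ `AbelianVariety.weilDiv`) is translation invariant — `D_Q ∈ Pic⁰` — by the theorem of the
square in the forms ★ `pullback_translation_weilDiv_add_linEquiv` (`t_P^*D_Q + D_P ∼ D_{QP}`) and ★ `weilDiv_mul_linEquiv` (`D_{QP} ∼ D_Q + D_P`).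
[cite: MumfordAV1970, §8 (iv) (p. 75) and §6 Cor. 4 (p. 59)] -/
theorem cechPic_pullback_translation_cechClass_weilDiv (Θ : CartierDivisor B.X.left) (Q P : B.Points k) :
    CechPic.pullback (B.translation P).left (B.weilDiv Θ Q).cechClass = (B.weilDiv Θ Q).cechClass := by
  have h1 := ((B.pullback_translation_weilDiv_add_linEquiv Θ P Q).trans (B.weilDiv_mul_linEquiv Θ Q P)).cechClass_eq
  rw [CartierDivisor.cechClass_add, CartierDivisor.cechClass_add, CartierDivisor.cechClass_pullback] at h1
  exact mul_right_cancel h1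

include hcov in
/-- **(b′) the class `[D_x]·[D]⁻¹` is acyclic**: for `D ∈ Pic⁰` (`t_P^*D ∼ D` for all `P`) and `x` with `D ≁ D_x`, a rank-one `M` of class `[D_x]·[D]⁻¹` has
`Ȟⁿ(𝓤, M) = 0` for every `n` (the class is translation invariant by `cechPic_pullback_translation_cechClass_weilDiv` and the hypothesis on `D`, and is `≠ 1`
because `[D_x]·[D]⁻¹ = 1 ⟺ D_x ∼ D`, ★ `cechClass_eq_iff_linEquiv`) — the `{x} × A`-slices in [MumfordAV1970] §8 proof of Thm. 1.
[cite: MumfordAV1970, §8 Thm. 1 (p. 77), proof] [cite: MumfordAV1970, §8 (vii) (p. 76)] -/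
theorem subsingleton_cechComplex_homology_of_detClass_eq_weilDiv_mul_inv [IsAlgClosed k] (Θ D : CartierDivisor B.X.left)
    (hD : ∀ P : B.Points k, (D.pullback (B.translation P).left).LinEquiv D) (x : B.Points k)
    (hx : ¬ D.LinEquiv (B.weilDiv Θ x))
    (hM : detClass (HasRank.isFiniteLocallyFree' h₁) = (B.weilDiv Θ x).cechClass * D.cechClass⁻¹) (n : ℤ) :
    Subsingleton ((cechComplex (fun i => (U i).1) M ρ).homology n) := by
  refine subsingleton_cechComplex_homology_of_detClass_translation_invariant B h₁ U hcov ρ (fun P => ?_) (fun h => hx ?_) n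
  · rw [hM, map_mul, map_inv, cechPic_pullback_translation_cechClass_weilDiv, ← CartierDivisor.cechClass_pullback,
      (hD P).cechClass_eq]
  · rw [hM, mul_inv_eq_one, CartierDivisor.cechClass_eq_iff_linEquiv] at h
    exact h.symm

include hcov in
/-- **(c′) the class `[D_y]` is acyclic off `K(Θ)`**: for `y` with `D_y ≁ 0` a rank-one `M` of class `[D_y]` has `Ȟⁿ(𝓤, M) = 0` for every `n`
(`[D_y]` is translation invariant, and `≠ 1 = [0]`, ★ `cechClass_zero`) — the `A × {y}`-slices, `y ∉ K(Θ)`, in [MumfordAV1970] §8 proof of Thm. 1.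
[cite: MumfordAV1970, §8 Thm. 1 (p. 77), proof] [cite: MumfordAV1970, §8 (vii) (p. 76)] -/
theorem subsingleton_cechComplex_homology_of_detClass_eq_weilDiv [IsAlgClosed k] (Θ : CartierDivisor B.X.left)
    (y : B.Points k) (hy : ¬ (B.weilDiv Θ y).LinEquiv 0)
    (hM : detClass (HasRank.isFiniteLocallyFree' h₁) = (B.weilDiv Θ y).cechClass) (n : ℤ) :
    Subsingleton ((cechComplex (fun i => (U i).1) M ρ).homology n) := by
  refine subsingleton_cechComplex_homology_of_detClass_translation_invariant B h₁ U hcov ρ (fun P => ?_) (fun h => hy ?_) n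
  · rw [hM, cechPic_pullback_translation_cechClass_weilDiv]
  · rw [hM, ← CartierDivisor.cechClass_zero, CartierDivisor.cechClass_eq_iff_linEquiv] at h
    exact h

omit [Fintype I] in
include hcov in
/-- **(c₀′) the class `[D_y]` at a point of `K(Θ)` has `Ȟ⁰ ≠ 0`**: for `y` with `D_y ∼ 0` (e.g. `y = 1`, ★ `weilDiv_one_linEquiv_zero`) a rank-one `M` of
class `[D_y] = 1` has `Ȟ⁰(𝓤, M) ≠ 0` — the slice `A × {0}` read at the end of [MumfordAV1970] §8 proof of Thm. 1 («`Γ(A, 𝒪_A) ≠ 0`»); no `k = k̄` needed.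
[cite: MumfordAV1970, §8 Thm. 1 (p. 77), proof] [cite: GortzWedhorn2023, Lemma 21.65 (p. 179)] -/
theorem nontrivial_cechComplex_homology_zero_of_detClass_eq_weilDiv (Θ : CartierDivisor B.X.left)
    (y : B.Points k) (hy : (B.weilDiv Θ y).LinEquiv 0)
    (hM : detClass (HasRank.isFiniteLocallyFree' h₁) = (B.weilDiv Θ y).cechClass) :
    Nontrivial ((cechComplex (fun i => (U i).1) M ρ).homology 0) := by
  refine nontrivial_cechComplex_homology_zero_of_detClass_eq_one B h₁ U hcov ρ ?_
  rw [hM, hy.cechClass_eq, CartierDivisor.cechClass_zero]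

end Classes

/-! ## §2 The two slices `{x} × A` and `A × {y}` of `A × A`, as cartesian squares, and the classes they see -/

section Slices

variable {k : Type} [Field k] (B : AbelianVariety k)

/-- A rational point followed by the structure map is the identity of `Spec k` (`Over.w`; the structure map of `specOver k k` is `Spec (𝟙)`). [folklore]
[cite: GortzWedhorn2023, Def. 27.1 (p. 799)] -/
private theorem toSpecHom_comp_hom (x : B.Points k) : x.toSpecHom ≫ B.X.hom = 𝟙 (Spec (.of k)) := by
  rw [AlgPoints.toSpecHom, Over.w x]
  change Spec.map (CommRingCat.ofHom (algebraMap k k)) = _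
  rw [Algebra.algebraMap_self, CommRingCat.ofHom_id, Spec.map_id]

/-- `sliceFst x ≫ p₁ = (A → Spec k) ≫ x`: the first slice `(x, 𝟙) : A → A × A` lies over the point `x` of the first factor. [folklore]
[cite: StacksProject, Tag 01JO] -/
theorem sliceFst_comp_fst (x : B.Points k) :
    (lift (toSpecOver B.X ≫ x) (𝟙 B.X)).left ≫ (fst B.X B.X).left = B.X.hom ≫ x.toSpecHom := by
  rw [← Over.comp_left, lift_fst, Over.comp_left, toSpecOver_left]

/-- `sliceFst x ≫ p₂ = 𝟙_A`. [folklore] [cite: StacksProject, Tag 01JO] -/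
theorem sliceFst_comp_snd (x : B.Points k) :
    (lift (toSpecOver B.X ≫ x) (𝟙 B.X)).left ≫ (snd B.X B.X).left = 𝟙 B.X.left := by
  rw [← Over.comp_left, lift_snd]
  rfl

/-- **`sliceFst x ≫ m = t_x`**: the first slice followed by the group law is the translation by `x` (★ `AbelianVariety.translation x = (A → Spec k → A) · 𝟙_A`
in the group `Hom_k(A, A)`, Mathlib `Hom.mul_def`). [cite: GortzWedhorn2023, Def. 27.1 (p. 799)] -/
theorem sliceFst_comp_mul (x : B.Points k) :
    (lift (toSpecOver B.X ≫ x) (𝟙 B.X)).left ≫ (μ[B.X]).left = (B.translation x).left := by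
  rw [← Over.comp_left, AbelianVariety.translation, Hom.mul_def]

/-- **The first slice is CARTESIAN: `A ≅ {x} × A = Spec k ×_{x, A, p₁} (A × A)`** — the square `sliceFst x ≫ p₁ = (A → Spec k) ≫ x` is a pullback
(paste the pullback square `A × A = A ×_k A` — Mathlib `IsPullback.of_hasPullback`, flipped — with the square of isomorphisms `sliceFst x ≫ p₂ = 𝟙`,
`x ≫ (A → Spec k) = 𝟙`; Mathlib `IsPullback.of_right`, `IsPullback.of_horiz_isIso`).  This is the (S2) fibre presentation the consumer hands to ★ (CBC-1)
`cechComplex_exactAt_of_forall_kPoint_isPullback`. [cite: StacksProject, Tag 01JO] [cite: Hartshorne1977, II Thm. 3.3 (fibres, p. 89)] -/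
theorem isPullback_sliceFst (x : B.Points k) :
    IsPullback (lift (toSpecOver B.X ≫ x) (𝟙 B.X)).left B.X.hom (fst B.X B.X).left x.toSpecHom := by
  have hR : IsPullback (snd B.X B.X).left (fst B.X B.X).left B.X.hom B.X.hom := (IsPullback.of_hasPullback B.X.hom B.X.hom).flip
  have h1 := sliceFst_comp_snd B x
  have h2 := toSpecHom_comp_hom B x
  refine IsPullback.of_right ?_ (sliceFst_comp_fst B x) hR
  haveI : IsIso ((lift (toSpecOver B.X ≫ x) (𝟙 B.X)).left ≫ (snd B.X B.X).left) := h1 ▸ inferInstance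
  haveI : IsIso (x.toSpecHom ≫ B.X.hom) := h2 ▸ inferInstance
  exact IsPullback.of_horiz_isIso ⟨by rw [h1, h2, Category.id_comp, Category.comp_id]⟩

/-- `sliceSnd y ≫ p₁ = 𝟙_A` for the second slice `(𝟙, y) : A → A × A`. [folklore] [cite: StacksProject, Tag 01JO] -/
theorem sliceSnd_comp_fst (y : B.Points k) :
    (lift (𝟙 B.X) (toSpecOver B.X ≫ y)).left ≫ (fst B.X B.X).left = 𝟙 B.X.left := by
  rw [← Over.comp_left, lift_fst]
  rfl

/-- `sliceSnd y ≫ p₂ = (A → Spec k) ≫ y`. [folklore] [cite: StacksProject, Tag 01JO] -/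
theorem sliceSnd_comp_snd (y : B.Points k) :
    (lift (𝟙 B.X) (toSpecOver B.X ≫ y)).left ≫ (snd B.X B.X).left = B.X.hom ≫ y.toSpecHom := by
  rw [← Over.comp_left, lift_snd, Over.comp_left, toSpecOver_left]

/-- **`sliceSnd y ≫ m = t_y`** (`𝟙_A · y_A = y_A · 𝟙_A` in the COMMUTATIVE group `Hom_k(A, A)`, ★ `AbelianVariety.instIsCommMonObj`).
[cite: GortzWedhorn2023, Def. 27.1 (p. 799)] [cite: MumfordAV1970, §4 (ii) (p. 41)] -/
theorem sliceSnd_comp_mul (y : B.Points k) :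
    (lift (𝟙 B.X) (toSpecOver B.X ≫ y)).left ≫ (μ[B.X]).left = (B.translation y).left := by
  rw [← Over.comp_left, AbelianVariety.translation, mul_comm, Hom.mul_def]

/-- **The second slice is CARTESIAN: `A ≅ A × {y} = (A × A) ×_{p₂, A, y} Spec k`** (as `isPullback_sliceFst`, with the unflipped product square).
[cite: StacksProject, Tag 01JO] [cite: Hartshorne1977, II Thm. 3.3 (fibres, p. 89)] -/
theorem isPullback_sliceSnd (y : B.Points k) :
    IsPullback (lift (𝟙 B.X) (toSpecOver B.X ≫ y)).left B.X.hom (snd B.X B.X).left y.toSpecHom := by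
  have hR : IsPullback (fst B.X B.X).left (snd B.X B.X).left B.X.hom B.X.hom := IsPullback.of_hasPullback B.X.hom B.X.hom
  have h1 := sliceSnd_comp_fst B y
  have h2 := toSpecHom_comp_hom B y
  refine IsPullback.of_right ?_ (sliceSnd_comp_snd B y) hR
  haveI : IsIso ((lift (𝟙 B.X) (toSpecOver B.X ≫ y)).left ≫ (fst B.X B.X).left) := h1 ▸ inferInstance
  haveI : IsIso (y.toSpecHom ≫ B.X.hom) := h2 ▸ inferInstance
  exact IsPullback.of_horiz_isIso ⟨by rw [h1, h2, Category.id_comp, Category.comp_id]⟩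

/-- Classes pulled back through a constant map `A → Spec k → A` are trivial (`Ȟ¹(Spec k, 𝒪^×) = 1`, ★ `CechPic.pullback_eq_one_of_isLocalRing`).
[cite: Hartshorne1977, II §6 (p. 143) and II Ex. 6.8] -/
theorem cechPic_pullback_hom_comp_toSpecHom (x : B.Points k) (c : CechPic B.X.left) :
    CechPic.pullback (B.X.hom ≫ x.toSpecHom) c = 1 := by
  rw [CechPic.pullback_comp, CechPic.pullback_eq_one_of_isLocalRing, map_one]

/-- **The class the first slice sees: `sliceFst(x)^*(m^*[Θ] · (p₁^*[Θ])⁻¹ · (p₂^*([Θ]·[D]))⁻¹) = [D_x] · [D]⁻¹`** — «`K|_{{x}×A} ≅ t_x^*L ⊗ L⁻¹ ⊗ M⁻¹`» in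
[MumfordAV1970] §8 proof of Thm. 1: `sliceFst ≫ m = t_x`, `sliceFst ≫ p₂ = 𝟙`, and `(sliceFst ≫ p₁)^* = 1` (constant map); `[D_x] = t_x^*[Θ]·[Θ]⁻¹`
(★ `cechClass_add`, `cechClass_pullback`, `cechClass_neg_eq_inv'`). [cite: MumfordAV1970, §8 Thm. 1 (p. 77), proof] [cite: Hartshorne1977, II Ex. 6.8] -/
theorem cechPic_pullback_sliceFst_kernelClass (Θ D : CartierDivisor B.X.left) (x : B.Points k) :
    CechPic.pullback (lift (toSpecOver B.X ≫ x) (𝟙 B.X)).left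
      (CechPic.pullback (μ[B.X]).left Θ.cechClass * (CechPic.pullback (fst B.X B.X).left Θ.cechClass)⁻¹ *
        (CechPic.pullback (snd B.X B.X).left (Θ.cechClass * D.cechClass))⁻¹) =
      (B.weilDiv Θ x).cechClass * D.cechClass⁻¹ := by
  rw [map_mul, map_mul, map_inv, map_inv, ← CechPic.pullback_comp, ← CechPic.pullback_comp, ← CechPic.pullback_comp,
    sliceFst_comp_mul, sliceFst_comp_fst, sliceFst_comp_snd, cechPic_pullback_hom_comp_toSpecHom, inv_one, mul_one, CechPic.pullback_id,
    AbelianVariety.weilDiv, CartierDivisor.cechClass_add, CartierDivisor.cechClass_pullback,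
    AbelianSchemes.AbelianSchemeOver.cechClass_neg_eq_inv', mul_inv, mul_assoc]

/-- **The class the second slice sees: `sliceSnd(y)^*(m^*[Θ] · (p₁^*[Θ])⁻¹ · (p₂^*([Θ]·[D]))⁻¹) = [D_y]`** — «`K|_{A×{y}} ≅ t_y^*L ⊗ L⁻¹`» in [MumfordAV1970]
§8 proof of Thm. 1: `sliceSnd ≫ m = t_y`, `sliceSnd ≫ p₁ = 𝟙`, and the `p₂^*` factor dies on the constant map `sliceSnd ≫ p₂`.
[cite: MumfordAV1970, §8 Thm. 1 (p. 77), proof] [cite: Hartshorne1977, II Ex. 6.8] -/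
theorem cechPic_pullback_sliceSnd_kernelClass (Θ D : CartierDivisor B.X.left) (y : B.Points k) :
    CechPic.pullback (lift (𝟙 B.X) (toSpecOver B.X ≫ y)).left
      (CechPic.pullback (μ[B.X]).left Θ.cechClass * (CechPic.pullback (fst B.X B.X).left Θ.cechClass)⁻¹ *
        (CechPic.pullback (snd B.X B.X).left (Θ.cechClass * D.cechClass))⁻¹) =
      (B.weilDiv Θ y).cechClass := by
  rw [map_mul, map_mul, map_inv, map_inv, ← CechPic.pullback_comp, ← CechPic.pullback_comp, ← CechPic.pullback_comp,
    sliceSnd_comp_mul, sliceSnd_comp_fst, sliceSnd_comp_snd, cechPic_pullback_hom_comp_toSpecHom, inv_one, mul_one, CechPic.pullback_id,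
    AbelianVariety.weilDiv, CartierDivisor.cechClass_add, CartierDivisor.cechClass_pullback,
    AbelianSchemes.AbelianSchemeOver.cechClass_neg_eq_inv']

end Slices

/-! ## §3 One kernel family: `K₀ = m^*𝒪(Θ) ⊗ (p₁^*𝒪(−Θ) ⊗ p₂^*𝒪(−(Θ + D)))` -/

section Family

variable {k : Type} [Field k] (B : AbelianVariety k) (Θ D : CartierDivisor B.X.left)

/-- **A kernel family exists**: `K₀ := m^*𝒪(Θ) ⊗ (p₁^*𝒪(−Θ) ⊗ p₂^*𝒪(−(Θ + D)))` on `A × A` has rank one (★ `hasRank_tensorObj_one`, ★ `hasRank_pullback`,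
★ `UnitCocycle.hasRank_lineBundle`) — Mumford's `m^*L ⊗ p₁^*L⁻¹ ⊗ p₂^*(L⁻¹ ⊗ M⁻¹)` for `L = 𝒪(Θ)`, `M = 𝒪(D)`, i.e. `Λ(L) ⊗ p₂^*M⁻¹` ([MumfordFogartyKirwan1994]
Ch. 6 §2 Def. 6.2's `Λ`). [cite: MumfordAV1970, §8 Thm. 1 (p. 77), proof] [cite: MumfordFogartyKirwan1994, Ch. 6 §2 Definition 6.2 (p. 120)] -/
theorem hasRank_kernelFamily :
    HasRank (tensorObj ((Scheme.Modules.pullback (μ[B.X]).left).obj (lineBundle Θ.toUnitCocycle))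
      (tensorObj ((Scheme.Modules.pullback (fst B.X B.X).left).obj (lineBundle (-Θ).toUnitCocycle))
        ((Scheme.Modules.pullback (snd B.X B.X).left).obj (lineBundle (-(Θ + D)).toUnitCocycle)))) 1 :=
  hasRank_tensorObj_one (hasRank_pullback _ Θ.toUnitCocycle.hasRank_lineBundle)
    (hasRank_tensorObj_one (hasRank_pullback _ (-Θ).toUnitCocycle.hasRank_lineBundle)
      (hasRank_pullback _ (-(Θ + D)).toUnitCocycle.hasRank_lineBundle))

/-- **The class of the kernel family `K₀`** is THE KERNEL CLASS `m^*[Θ] · (p₁^*[Θ])⁻¹ · (p₂^*([Θ]·[D]))⁻¹` (★ `detClass_tensorObj_of_hasRank_one`,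
★ `detClass_pullback`, ★ `detClass_lineBundle_toUnitCocycle`, `[−E] = [E]⁻¹`). [cite: MumfordAV1970, §8 Thm. 1 (p. 77), proof] [cite: Hartshorne1977, II Ex. 6.8 and III Ex. 4.5] -/
theorem detClass_kernelFamily
    (h : IsFiniteLocallyFree (tensorObj ((Scheme.Modules.pullback (μ[B.X]).left).obj (lineBundle Θ.toUnitCocycle))
      (tensorObj ((Scheme.Modules.pullback (fst B.X B.X).left).obj (lineBundle (-Θ).toUnitCocycle))
        ((Scheme.Modules.pullback (snd B.X B.X).left).obj (lineBundle (-(Θ + D)).toUnitCocycle))))) :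
    detClass h = CechPic.pullback (μ[B.X]).left Θ.cechClass * (CechPic.pullback (fst B.X B.X).left Θ.cechClass)⁻¹ *
        (CechPic.pullback (snd B.X B.X).left (Θ.cechClass * D.cechClass))⁻¹ := by
  have hm₁ := hasRank_pullback (μ[B.X]).left Θ.toUnitCocycle.hasRank_lineBundle
  have h1₁ := hasRank_pullback (fst B.X B.X).left (-Θ).toUnitCocycle.hasRank_lineBundle
  have h2₁ := hasRank_pullback (snd B.X B.X).left (-(Θ + D)).toUnitCocycle.hasRank_lineBundle
  have hmf := Θ.toUnitCocycle.isFiniteLocallyFree_lineBundle.pullback (μ[B.X]).left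
  have h1f := (-Θ).toUnitCocycle.isFiniteLocallyFree_lineBundle.pullback (fst B.X B.X).left
  have h2f := (-(Θ + D)).toUnitCocycle.isFiniteLocallyFree_lineBundle.pullback (snd B.X B.X).left
  have h12f := isFiniteLocallyFree_tensorObj _ _ h1f h2f
  rw [detClass_tensorObj_of_hasRank_one hm₁ (hasRank_tensorObj_one h1₁ h2₁) hmf h12f h,
    detClass_tensorObj_of_hasRank_one h1₁ h2₁ h1f h2f h12f, detClass_pullback _ Θ.toUnitCocycle.isFiniteLocallyFree_lineBundle,
    detClass_pullback _ (-Θ).toUnitCocycle.isFiniteLocallyFree_lineBundle,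
    detClass_pullback _ (-(Θ + D)).toUnitCocycle.isFiniteLocallyFree_lineBundle, detClass_lineBundle_toUnitCocycle,
    detClass_lineBundle_toUnitCocycle, detClass_lineBundle_toUnitCocycle, AbelianSchemes.AbelianSchemeOver.cechClass_neg_eq_inv',
    AbelianSchemes.AbelianSchemeOver.cechClass_neg_eq_inv', CartierDivisor.cechClass_add, map_inv, map_inv, mul_assoc]

end Family

/-! ## §4 The slices of a kernel family: all Čech cohomology vanishes off the two exceptional loci, `Ȟ⁰ ≠ 0` at `y = 1` -/

section Heads

variable {k : Type} [Field k] (B : AbelianVariety k) (Θ D : CartierDivisor B.X.left) {K : (B.X ⊗ B.X).left.Modules}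
  (hK : HasRank K 1)
  (hKc : detClass (HasRank.isFiniteLocallyFree' hK) =
    CechPic.pullback (μ[B.X]).left Θ.cechClass * (CechPic.pullback (fst B.X B.X).left Θ.cechClass)⁻¹ *
      (CechPic.pullback (snd B.X B.X).left (Θ.cechClass * D.cechClass))⁻¹)
  {I : Type} [LinearOrder I] [Fintype I] (U : I → B.X.left.affineOpens) (hcov : ⨆ i, (U i).1 = ⊤)
  {R : Type} [CommRing R] (ρ : R →+* Γ(B.X.left, ⊤))

include hKc hcov in
/-- **(b) THE FIRST-FACTOR SLICES OF A KERNEL FAMILY ARE ACYCLIC**: `k = k̄`, `D ∈ Pic⁰`, `K` of rank one with the kernel class; for every `x ∈ A(k)` with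
`D ≁ D_x`, every finite affine open cover `𝓤` of `A`, any scalars and every `n : ℤ`: `Ȟⁿ(𝓤, sliceFst(x)^*K) = 0` (§1 (b′) on the class of §2).
[cite: MumfordAV1970, §8 Thm. 1 (p. 77), proof] [cite: MumfordAV1970, §8 (vii) (p. 76)] -/
theorem subsingleton_cechComplex_homology_pullback_sliceFst [IsAlgClosed k]
    (hD : ∀ P : B.Points k, (D.pullback (B.translation P).left).LinEquiv D) (x : B.Points k)
    (hx : ¬ D.LinEquiv (B.weilDiv Θ x)) (n : ℤ) :
    Subsingleton ((cechComplex (fun i => (U i).1)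
      ((Scheme.Modules.pullback (lift (toSpecOver B.X ≫ x) (𝟙 B.X)).left).obj K) ρ).homology n) :=
  subsingleton_cechComplex_homology_of_detClass_eq_weilDiv_mul_inv B (hasRank_pullback _ hK) U hcov ρ Θ D hD x hx
    (by rw [← cechPic_pullback_sliceFst_kernelClass B Θ D x, ← hKc, ← detClass_pullback _ (HasRank.isFiniteLocallyFree' hK)]) n

include hKc hcov in
/-- **(b), `ExactAt` form** — the shape consumed by ★ (CBC-1) `cechComplex_exactAt_of_forall_kPoint_isPullback` together with `isPullback_sliceFst`
(cover `sliceFst(x)⁻¹(p₂⁻¹𝓤_j) = 𝓤_j`). [cite: MumfordAV1970, §8 Thm. 1 (p. 77), proof] -/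
theorem exactAt_cechComplex_pullback_sliceFst [IsAlgClosed k]
    (hD : ∀ P : B.Points k, (D.pullback (B.translation P).left).LinEquiv D) (x : B.Points k)
    (hx : ¬ D.LinEquiv (B.weilDiv Θ x)) (n : ℤ) :
    (cechComplex (fun i => (U i).1)
      ((Scheme.Modules.pullback (lift (toSpecOver B.X ≫ x) (𝟙 B.X)).left).obj K) ρ).ExactAt n := by
  rw [exactAt_iff_subsingleton_homology]
  exact subsingleton_cechComplex_homology_pullback_sliceFst B Θ D hK hKc U hcov ρ hD x hx n

include hKc hcov in
/-- **(c) THE SECOND-FACTOR SLICES OF A KERNEL FAMILY OFF `K(Θ)` ARE ACYCLIC**: `k = k̄`, `K` of rank one with the kernel class; for every `y ∈ A(k)` with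
`D_y ≁ 0`, every finite affine open cover `𝓤` of `A`, any scalars, every `n : ℤ`: `Ȟⁿ(𝓤, sliceSnd(y)^*K) = 0` (§1 (c′) on the class of §2; no hypothesis on `D`).
[cite: MumfordAV1970, §8 Thm. 1 (p. 77), proof] [cite: MumfordAV1970, §8 (vii) (p. 76)] -/
theorem subsingleton_cechComplex_homology_pullback_sliceSnd [IsAlgClosed k] (y : B.Points k)
    (hy : ¬ (B.weilDiv Θ y).LinEquiv 0) (n : ℤ) :
    Subsingleton ((cechComplex (fun i => (U i).1)
      ((Scheme.Modules.pullback (lift (𝟙 B.X) (toSpecOver B.X ≫ y)).left).obj K) ρ).homology n) :=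
  subsingleton_cechComplex_homology_of_detClass_eq_weilDiv B (hasRank_pullback _ hK) U hcov ρ Θ y hy
    (by rw [← cechPic_pullback_sliceSnd_kernelClass B Θ D y, ← hKc, ← detClass_pullback _ (HasRank.isFiniteLocallyFree' hK)]) n

include hKc hcov in
/-- **(c), `ExactAt` form** (with `isPullback_sliceSnd` the (S2) input of ★ (CBC-1) along `p₂`). [cite: MumfordAV1970, §8 Thm. 1 (p. 77), proof] -/
theorem exactAt_cechComplex_pullback_sliceSnd [IsAlgClosed k] (y : B.Points k)
    (hy : ¬ (B.weilDiv Θ y).LinEquiv 0) (n : ℤ) :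
    (cechComplex (fun i => (U i).1)
      ((Scheme.Modules.pullback (lift (𝟙 B.X) (toSpecOver B.X ≫ y)).left).obj K) ρ).ExactAt n := by
  rw [exactAt_iff_subsingleton_homology]
  exact subsingleton_cechComplex_homology_pullback_sliceSnd B Θ D hK hKc U hcov ρ y hy n

include hKc hcov in
omit [Fintype I] in
/-- **(c₀) THE SECOND-FACTOR SLICE OF A KERNEL FAMILY AT A POINT OF `K(Θ)` HAS `Ȟ⁰ ≠ 0`**: for `y` with `D_y ∼ 0` (e.g. `y = 1`) and every cover of the
integral `A`, `Ȟ⁰(𝓤, sliceSnd(y)^*K) ≠ 0` (§1 (c₀′); any field `k`). [cite: MumfordAV1970, §8 Thm. 1 (p. 77), proof] [cite: GortzWedhorn2023, Lemma 21.65 (p. 179)] -/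
theorem nontrivial_cechComplex_homology_zero_pullback_sliceSnd (y : B.Points k) (hy : (B.weilDiv Θ y).LinEquiv 0) :
    Nontrivial ((cechComplex (fun i => (U i).1)
      ((Scheme.Modules.pullback (lift (𝟙 B.X) (toSpecOver B.X ≫ y)).left).obj K) ρ).homology 0) :=
  nontrivial_cechComplex_homology_zero_of_detClass_eq_weilDiv B (hasRank_pullback _ hK) U hcov ρ Θ y hy
    (by rw [← cechPic_pullback_sliceSnd_kernelClass B Θ D y, ← hKc, ← detClass_pullback _ (HasRank.isFiniteLocallyFree' hK)])

include hKc hcov in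
omit [Fintype I] in
/-- **(c₀), `¬ ExactAt 0` form** — what contradicts ★ (CBC-1∕E2) `cechComplex_exactAt_of_isPullback_of_exactAt` at `y = 1` (★ `weilDiv_one_linEquiv_zero`) in
the last line of [MumfordAV1970] §8 proof of Thm. 1. [cite: MumfordAV1970, §8 Thm. 1 (p. 77), proof] -/
theorem not_exactAt_zero_cechComplex_pullback_sliceSnd (y : B.Points k) (hy : (B.weilDiv Θ y).LinEquiv 0) :
    ¬ (cechComplex (fun i => (U i).1)
      ((Scheme.Modules.pullback (lift (𝟙 B.X) (toSpecOver B.X ≫ y)).left).obj K) ρ).ExactAt 0 := by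
  rw [exactAt_iff_subsingleton_homology, not_subsingleton_iff_nontrivial]
  exact nontrivial_cechComplex_homology_zero_pullback_sliceSnd B Θ D hK hKc U hcov ρ y hy

end Heads

end Literature.AlgebraicGeometry.AbelianVarieties

end
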